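import Summits.QuantumFields.BalabanUV.Beta.D1BFx.TorusCombKKTSh
import Summits.QuantumFields.BalabanUV.Beta.D1BFx.TorusGaugeBasis

/-!
# `BalabanUV.Beta.D1BFx.TorusGaugeBasisC` — road «BF-x», binder row D1, slot (K), PART 23 «PART 8‴ COMB SKELETON» (an2 R-D1-g43-1, OWNER d1-p2 g22
# `PART23-COMB-SKELETON-SPEC`), brick **TB3′ «THE GAUGE BASIS FROM THE COMB ON THE TORUS AT CHART (III′)»** — the comb twin of `TorusGaugeBasis` (TB3,
# PART 1): the periodised CENTRED-COMB (rooted-axial, root `ρ_c = ctr (d+1) n`) projector `Π̂′ := (fTL (sortK n (trK (piK ρ_c n))))^`, the basis matrix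
# **`Ŵ′₀ := (1 − Π̂′)·τ_Tᵀ`** of the (III′) gauge slice, and its four letters on every coarse torus:
# `τ_T·Ŵ′₀ = 1`, `Ŵ′₀·τ_T = 1 − Π̂′`, **`K̂·Ŵ′₀ = 0`** (WARD-L at order 0) and **`Q̂′·Ŵ′₀ = 0`** (the kinematic letter of the SHIFTED averaging
# `Q̂′ = Q̂ + D̂sh` of `TorusCombKKTSh`).

WHY and WHAT IS LOCATED ([folklore], read off tree definitions).  The K-combine identity (`KCombineCov.hessT_transfer_wardL` ∕ `identity_array_currency_cov_What0`)
needs a basis `W₀` of the gauge modes with `K₀W₀ = 0`, `Q₀W₀ = 0`, `det(τW₀) ≠ 0`.  At the bm chart TB3 takes `W₀ := What0 r n p = (1 − Π̂_bm)·τ_Tᵀ` and the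
kinematic letter `Q̂·Ŵ₀ = 0` rests on `BorderedHessianBlind.comp_bhK_trK_piKBm` (`bhK ∘ Π_bmᵀ = bhK`).  At chart (III′) the averaging rows are `Q̂′ = Q̂ + D̂sh`
(an1's symmetrised border), and the blindness the tree PROVES for the shifted border is to the CENTRED COMB dressing — an2's
`CombChartSpreadBlind.comp_bhKStepSh_trK_piK : ∀ j, comp (bhKStepSh d Lc (Dsh Lc) j) (trK (piK (ctr (d+1) Lc) Lc)) = bhKStepSh …` («the straight `bhK N`
alone is NOT blind to `piK (ctr)` (X-an2-42) — the (0.4) legs cancel the defect») — so the (III′) gauge slice is spanned by the gradients of the CENTRED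
TREE gauge functions (no block-mean subtraction): `Ŵ′₀ = (1 − Π̂′)·τ_Tᵀ` with `Π̂′` the periodised `trK (piK ρ_c n)`.  This file is TB3's §1–§3 with
`(piKBm (toSite r), pmBm, axProjBmAt, comp_bhK_trK_piKBm, Qhat) ↦ (piK ρ_c, pm, axProjAt, comp_bhKStepSh_trK_piK 0, QhatSh)`; the in-block-root hypothesis
`hr` disappears (`ρ_c = toSite (ctrOff (d+1) n)`, `ctrOff_mem_box`).
NOT HERE (next brick): the basis MATRIX `N̂′` (columns = periodised `treeGaugeAt ρ_c (delta1 b) n`) with `Ŵ′₀ = ĝrad·N̂′` — the twin of `TorusGaugeBasisMatrix`.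

HONEST FRAMING (cell contract, verbatim): «discharging `BetaPertH` makes Bałaban's UV stability UNCONDITIONAL — a real constructive-QFT result; it
is NOT the continuum limit and NOT the Clay problem.»  HONEST DEPENDENCY (verbatim): «continuum YM on T⁴ ⇐ BetaPertH ∧ nine spine estimates (0/9
proved); BetaPertH ⇐ (D1) ∧ (D4) ∧ CAP+tail; G-an2-4 gates asym, D1 and NE2/3/4.»  [folklore] bookkeeping BY NAME; no `Prop` is minted, nothing is
cited, no wall binder is instantiated; 0 sorry.  Discharges NOTHING of (K), of hW ∕ hR ∕ D1Tel ∕ D1Rep (0∕4), of D1 or of BetaPertH; NOT continuum, NOT Clay.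
ABSOLUTE RULE (cell, verbatim): «No internally-minted statement may enter as a cited fact. Every hypothesis is either kernel-proved in this package or a
verbatim quotation of a PUBLISHED theorem with page reference. The manuscript(s) under audit are NOT citable for their own disputed steps — they are
the thing under adjudication; programme-internal (2001/route/tribunal) claims are never citable.»

CONTENT (all [folklore]; every `d`, block side `n ≥ 1`, coarse period `p ≥ 1`; root `ρ_c = ctr (d+1) n`):
* §1 [our objects] `PiHatC n p`, **`What0C n p`**; `shiftK_trK_piK_ctr`, `PiHatC_eq_transpose`.
* §2 `PiHatC_apply_of_comb` (comb rows vanish: `pm_eq_zero_of_isCombBond`), `PiHatC_apply_of_not_comb` (non-comb columns are unit vectors: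
  `axialGaugeAt_delta1_of_not_isCombBond` + `RootedComb.axProjAt_eq_self_of_axialGaugeAt`), `tauT_mul_PiHatC = 0`, **`tauT_mul_What0C = 1`**,
  `isUnit_det_tauT_mul_What0C`, `PiHatC_mul_one_sub`, `one_sub_PiHatC_mul_one_sub`, `What0C_mul_tauT`.
* §3 `fBL_sortK_trK_piK_ctr`, `bhKStepSh_zero_inr_col_off`, **`blocksHat_bhKStepSh_zero_mul`** (`(sortK (bhK + Dsh))^·(sortK Π̂′ᵀ)^ = (sortK (bhK + Dsh))^`),
  `Khat_mul_PiHatC_and`, **`Khat_mul_PiHatC`**, **`QhatSh_mul_PiHatC`**, **`Khat_mul_What0C = 0`**, **`QhatSh_mul_What0C = 0`**.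
Provenance: D1 formalisation swarm, unit `b2b-balaban-beta-d1-formalise-leaf-03` (gen 28), brick «K-TB3′» part 1, 2026-08-22; template `TorusGaugeBasis` (gen 8);
letters of an2 (`CombChartSpreadBlind`, `SymRootedAveragingMatrix`, `AxialDressingRootedKernel`) and TB1′ (`TorusCombKKTSh`) BY NAME; no existing file touched.
-/

noncomputable section

namespace Summit.QuantumFields.BalabanUV.Beta.D1BFx.TorusGaugeBasisC

open Matrix
open Literature.Probability.LatticeModels (TorusSite Torus.proj)
open Literature.MathematicalPhysics.QuantumFieldTheory.LatticeForm (repZ quo)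
open Literature.MathematicalPhysics.QuantumFieldTheory.Balaban1983to89
open Literature.MathematicalPhysics.QuantumFieldTheory.Balaban1983to89.Beta
open RootedComb (axProjAt_eq_self_of_axialGaugeAt)
open ExpKernelCalculus (MKer Decays comp shiftK)
open AffineAveraging (box toSite)
open AveragingContoursRooted (ctr ctrOff ctrOff_mem_box)
open KKTFluctuationKernel (delta1 delta1_apply)
open OneStepResolventKernel (Fib)
open Summit.QuantumFields.BalabanUV.Beta.TameKernelCalculus (Spr trK trK_apply)
open Summit.QuantumFields.BalabanUV.Beta.AxialDressingRooted (IsCombBondAt piK piK_inl_inl piK_inl_inr pm_eq_zero_of_isCombBond shiftK_piK spr_trK_piK)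
open Summit.QuantumFields.BalabanUV.Beta.SymRootedAveragingMatrix (piK_inl_inl_eq)
open Summit.QuantumFields.BalabanUV.Beta.BorderedHessian (bhK bhK_inr_col_off axialGaugeAt_delta1_of_not_isCombBond)
open Summit.QuantumFields.BalabanUV.Beta.SymShiftedSpread (bhKStepSh bhKStepSh_zero)
open Summit.QuantumFields.BalabanUV.Beta.DshAn1 (Dsh Dsh_inl_inr Dsh_inr_inr)
open Summit.QuantumFields.BalabanUV.Beta.CombChartSpreadBlind (comp_bhKStepSh_trK_piK)
open Summit.QuantumFields.BalabanUV.Beta.FP.RelInvPeriodisedComb (spr_bhKStepSh_Dsh)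
open Summit.QuantumFields.BalabanUV.Beta.D1BFx.FibredPeriodisation
open Summit.QuantumFields.BalabanUV.Beta.D1BFx.SortedKernels
open Summit.QuantumFields.BalabanUV.Beta.D1BFx.SortedReblocking
open Summit.QuantumFields.BalabanUV.Beta.D1BFx.SortedPack
open Summit.QuantumFields.BalabanUV.Beta.D1BFx.SortedRelInv
open Summit.QuantumFields.BalabanUV.Beta.D1BFx.TorusCombKKT (I J CombRows tauT tauT_apply tauT_mul_transpose one_sub_transpose_mul_tauT_apply
  isCombBondAt_finePt_iff Khat)
open Summit.QuantumFields.BalabanUV.Beta.D1BFx.TorusCombKKTSh (QhatSh fTL_sortK_bhKStepSh_zero_eq_Khat)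
open Summit.QuantumFields.BalabanUV.Beta.D1BFx.TorusGaugeBasis (periodise_sortK_comp')
open scoped BigOperators

variable {d : ℕ} (n p : ℕ) [NeZero n] [NeZero p]

/-! ## §1 The periodised centred-comb projector and the gauge-basis matrix -/

/-- [our object] **`Π̂′`**: the ff block of the periodised sorted TRANSPOSED centred-comb projector kernel `(piK ρ_c n)ᵀ` on the coarse torus of period `p`. -/
def PiHatC : Matrix (I d n p) (I d n p) ℝ := Matrix.of (periodiseF p (fTL (sortK n (trK (piK (ctr (d + 1) n) n)))))

/-- [our object] **`Ŵ′₀ := (1 − Π̂′)·τ_Tᵀ`**: column `b` = `δ_b − Π̂′ᵀ-image` = the gradient of the centred TREE gauge function of the comb bond `b` (the basis of the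
(III′) gauge slice). -/
def What0C : Matrix (I d n p) (CombRows (ctr (d + 1) n) n p) ℝ := (1 - PiHatC (d := d) n p) * (tauT (ctr (d + 1) n) n p)ᵀ

omit [NeZero p] in
/-- [folklore] The transposed centred-comb projector kernel is block covariant. -/
theorem shiftK_trK_piK_ctr (t : Fin (d + 1) → ℤ) : shiftK ((n : ℤ) • t) (trK (piK (ctr (d + 1) n) n)) = trK (piK (ctr (d + 1) n) n) := by
  refine blockCov_of_neg (fun t => ?_) t
  show trK (shiftK (-((n : ℤ) • t)) (piK (ctr (d + 1) n) n)) = _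
  rw [shiftK_piK _ (NeZero.one_le (n := n))]

/-- [folklore] **THE TRANSPOSED READING**: `Π̂′ = ((fTL (sortK n (piK ρ_c n)))^)ᵀ`. -/
theorem PiHatC_eq_transpose :
    PiHatC (d := d) n p = (Matrix.of (periodiseF p (fTL (sortK n (piK (ctr (d + 1) n) n)))))ᵀ := by
  rw [← periodiseF_trF (fun a b => isPeriodic₂_sortK (blockCov_of_neg fun t => shiftK_piK _ (NeZero.one_le (n := n)) t) p (Sum.inl a) (Sum.inl b))]
  rfl

/-! ## §2 Comb rows and non-comb columns of `Π̂′`; `τ_T·Ŵ′₀ = 1`, `Ŵ′₀·τ_T = 1 − Π̂′` -/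

/-- [folklore] **THE COMB ROWS OF `Π̂′` VANISH** (`Π_c` lands in the centred axial gauge: `pm_eq_zero_of_isCombBond`). -/
theorem PiHatC_apply_of_comb (i j : I d n p) (hi : IsCombBondAt (ctr (d + 1) n) n i.2.2 (repZ i.2.1)) : PiHatC (d := d) n p i j = 0 := by
  obtain ⟨x, z, α⟩ := i
  obtain ⟨y, z', β⟩ := j
  rw [PiHatC, Matrix.of_apply, periodiseF_apply]
  unfold periodise₂
  rw [show (fun t : Fin (d + 1) → ℤ => Kfib (fTL (sortK n (trK (piK (ctr (d + 1) n) n)))) (z, α) (z', β) (windowMap (d + 1) p x)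
        (imageShift p (windowMap (d + 1) p y) t)) = fun _ => 0 from funext fun t => ?_]
  · exact tsum_zero
  · rw [Kfib_apply]
    show sortK n (trK (piK (ctr (d + 1) n) n)) (_, Sum.inl (z, α)) (_, Sum.inl (z', β)) = 0
    rw [sortK_inl_inl, trK_apply, piK_inl_inl]
    split_ifs
    · rw [pm_eq_zero_of_isCombBond ((isCombBondAt_finePt_iff (ctr (d + 1) n) n α _ z).2 hi) _ _, Int.cast_zero]
    · rfl

/-- [folklore] **A NON-COMB COLUMN OF `Π̂′` IS THE UNIT VECTOR**: the indicator of a non-comb bond is in the centred axial gauge, so `Π_c` fixes it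
(`axialGaugeAt_delta1_of_not_isCombBond`, `RootedComb.axProjAt_eq_self_of_axialGaugeAt`; root `ρ_c = toSite (ctrOff (d+1) n)`). -/
theorem PiHatC_apply_of_not_comb (i j : I d n p) (hj : ¬ IsCombBondAt (ctr (d + 1) n) n j.2.2 (repZ j.2.1)) :
    PiHatC (d := d) n p i j = if i = j then 1 else 0 := by
  have hn : 1 ≤ n := NeZero.one_le
  have hr : ctrOff (d + 1) n ∈ box (d + 1) n := ctrOff_mem_box hn
  obtain ⟨x, z, α⟩ := i
  obtain ⟨y, z', β⟩ := j
  rw [← periodiseF_kdeltaF, PiHatC, Matrix.of_apply, periodiseF_apply, periodiseF_apply]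
  unfold periodise₂
  refine tsum_congr fun t => ?_
  rw [Kfib_apply, Kfib_apply]
  show sortK n (trK (piK (ctr (d + 1) n) n)) (_, Sum.inl (z, α)) (_, Sum.inl (z', β)) = _
  have hc : ¬ IsCombBondAt (toSite (ctrOff (d + 1) n)) n β (finePt n (imageShift p (windowMap (d + 1) p y) t) z') := by
    rw [isCombBondAt_finePt_iff]; exact hj
  rw [sortK_inl_inl, trK_apply, show ctr (d + 1) n = toSite (ctrOff (d + 1) n) from rfl, piK_inl_inl_eq hn hr,
    axProjAt_eq_self_of_axialGaugeAt hn (axialGaugeAt_delta1_of_not_isCombBond hn hr hc), delta1_apply, kdeltaF]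
  simp only [finePt_eq_iff, Prod.mk.injEq]
  by_cases h1 : α = β
  · by_cases h2 : windowMap (d + 1) p x = imageShift p (windowMap (d + 1) p y) t
    · by_cases h3 : z = z'
      · simp [h1, h2, h3]
      · simp [h3]
    · simp [h2]
  · simp [h1]

/-- [folklore] **`τ_T·Π̂′ = 0`** (the comb rows of `Π̂′` vanish). -/
theorem tauT_mul_PiHatC : tauT (ctr (d + 1) n) n p * PiHatC (d := d) n p = 0 := by
  ext rr j
  rw [Matrix.mul_apply, Matrix.zero_apply]
  simp only [tauT_apply, ite_mul, one_mul, zero_mul, Finset.sum_ite_eq', Finset.mem_univ, if_true]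
  exact PiHatC_apply_of_comb n p _ _ rr.2

/-- [folklore] **`τ_T·Ŵ′₀ = 1`**. -/
theorem tauT_mul_What0C : tauT (ctr (d + 1) n) n p * What0C (d := d) n p = 1 := by
  rw [What0C, ← Matrix.mul_assoc, Matrix.mul_sub, Matrix.mul_one, tauT_mul_PiHatC, sub_zero, tauT_mul_transpose]

/-- [folklore] Hence `det (τ_T·Ŵ′₀)` is a unit — the `hτ` of K-TA4G at chart (III′). -/
theorem isUnit_det_tauT_mul_What0C : IsUnit (tauT (ctr (d + 1) n) n p * What0C (d := d) n p).det := by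
  rw [tauT_mul_What0C, Matrix.det_one]
  exact isUnit_one

open Classical in
/-- [folklore] **`Π̂′·(1 − τ_Tᵀτ_T) = 1 − τ_Tᵀτ_T`**: `Π̂′` is the identity on the non-comb coordinates. -/
theorem PiHatC_mul_one_sub :
    PiHatC (d := d) n p * (1 - (tauT (ctr (d + 1) n) n p)ᵀ * tauT (ctr (d + 1) n) n p)
      = 1 - (tauT (ctr (d + 1) n) n p)ᵀ * tauT (ctr (d + 1) n) n p := by
  ext i j
  rw [Matrix.mul_apply, one_sub_transpose_mul_tauT_apply]
  simp only [one_sub_transpose_mul_tauT_apply, mul_ite, mul_one, mul_zero]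
  by_cases hc : IsCombBondAt (ctr (d + 1) n) n j.2.2 (repZ j.2.1)
  · rw [Finset.sum_eq_zero]
    · split_ifs with h
      · exact absurd (h.1 ▸ hc) (h.1 ▸ h.2)
      · rfl
    · intro k _
      split_ifs with h
      · exact absurd (h.1 ▸ hc) (h.1 ▸ h.2)
      · rfl
  · rw [Finset.sum_eq_single j]
    · rw [if_pos ⟨rfl, hc⟩, PiHatC_apply_of_not_comb n p i j hc]
      by_cases hij : i = j
      · subst hij; simp [hc]
      · simp [hij]
    · intro k _ hk
      rw [if_neg (fun h => hk h.1)]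
    · intro h; exact absurd (Finset.mem_univ _) h

/-- [folklore] **`(1 − Π̂′)·(1 − τ_Tᵀτ_T) = 0`**: `1 − Π̂′` only sees the comb coordinates. -/
theorem one_sub_PiHatC_mul_one_sub :
    (1 - PiHatC (d := d) n p) * (1 - (tauT (ctr (d + 1) n) n p)ᵀ * tauT (ctr (d + 1) n) n p) = 0 := by
  rw [Matrix.sub_mul, Matrix.one_mul, PiHatC_mul_one_sub n p, sub_self]

/-- [folklore] **`Ŵ′₀·τ_T = 1 − Π̂′`**. -/
theorem What0C_mul_tauT : What0C (d := d) n p * tauT (ctr (d + 1) n) n p = 1 - PiHatC (d := d) n p := by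
  have h := one_sub_PiHatC_mul_one_sub (d := d) n p
  rw [Matrix.mul_sub, Matrix.mul_one, sub_eq_zero] at h
  rw [What0C, Matrix.mul_assoc, ← h]

/-! ## §3 Right blindness of `K̂` and `Q̂′` to `Π̂′`; the Ward letters `K̂·Ŵ′₀ = 0`, `Q̂′·Ŵ′₀ = 0` -/

omit [NeZero n] [NeZero p] in
/-- [folklore] The mf block of the sorted transposed centred-comb kernel vanishes (`piK_inl_inr`). -/
theorem fBL_sortK_trK_piK_ctr : fBL (sortK n (trK (piK (ctr (d + 1) n) n))) = fun _ _ => (0 : ℝ) := by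
  funext ⟨x, mm⟩ ⟨y, z, b⟩
  show sortK n (trK (piK (ctr (d + 1) n) n)) (x, Sum.inr mm) (y, Sum.inl (z, b)) = 0
  rw [sortK_inr_inl, trK_apply, piK_inl_inr]

omit [NeZero p] in
/-- [folklore] Multiplier COLUMNS of the level-`0` legged border `bhK n + Dsh n` vanish off the coarse sublattice (`bhK_inr_col_off`; `Dsh_inl_inr` carries
the factor `[proj n y = 0]`, `Dsh_inr_inr = 0`). -/
theorem bhKStepSh_zero_inr_col_off (x y : Fin (d + 1) → ℤ) (a : Fib d) (f : Fin (d + 1)) (hy : Torus.proj n y ≠ 0) :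
    bhKStepSh d n (Dsh n) 0 x y a (Sum.inr f) = 0 := by
  rw [bhKStepSh_zero]
  show bhK n x y a (Sum.inr f) + Dsh n x y a (Sum.inr f) = 0
  rw [bhK_inr_col_off n hy]
  rcases a with α | m
  · rw [Dsh_inl_inr, if_neg hy, add_zero]
  · rw [Dsh_inr_inr, add_zero]

/-- [folklore] **`(sortK (bhK + Dsh))^ · (sortK Π̂′ᵀ)^ = (sortK (bhK + Dsh))^`** on every coarse torus — an2's `CombChartSpreadBlind.comp_bhKStepSh_trK_piK 0`
periodised in the sorted currency. -/
theorem blocksHat_bhKStepSh_zero_mul :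
    blocksHat p (sortK n (bhKStepSh d n (Dsh (d := d) n) 0)) * blocksHat p (sortK n (trK (piK (ctr (d + 1) n) n)))
      = blocksHat p (sortK n (bhKStepSh d n (Dsh (d := d) n) 0)) := by
  have hn : 1 ≤ n := NeZero.one_le
  have hr : ctrOff (d + 1) n ∈ box (d + 1) n := ctrOff_mem_box hn
  have h := periodise_sortK_comp' (q := p) (spr_bhKStepSh_Dsh (d := d) (Lc := n) 0)
    (show Spr (trK (piK (ctr (d + 1) n) n)) from spr_trK_piK hn hr) (shiftK_trK_piK_ctr n)
    (fun x y a f hy => bhKStepSh_zero_inr_col_off n x y a f hy)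
  rw [comp_bhKStepSh_trK_piK (d := d) (Lc := n) 0] at h
  rw [blocksHat_eq_reindex, blocksHat_eq_reindex, Matrix.reindex_apply, Matrix.reindex_apply, Matrix.submatrix_mul_equiv, ← h]

/-- [folklore] The block identities: `K̂·Π̂′ = K̂` (ff) and `Q̂′·Π̂′ = Q̂′` (mf). -/
theorem Khat_mul_PiHatC_and :
    Khat (d := d) n p * PiHatC (d := d) n p = Khat (d := d) n p ∧ QhatSh (d := d) n p * PiHatC (d := d) n p = QhatSh (d := d) n p := by
  have h := blocksHat_bhKStepSh_zero_mul (d := d) n p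
  rw [blocksHat, blocksHat, Matrix.fromBlocks_multiply, fBL_sortK_trK_piK_ctr, periodiseF_zero, Matrix.mul_zero, Matrix.mul_zero, add_zero,
    add_zero, Matrix.fromBlocks_inj, fTL_sortK_bhKStepSh_zero_eq_Khat] at h
  exact ⟨h.1, h.2.2.1⟩

/-- [folklore] **`K̂·Π̂′ = K̂`** — the curvature block is blind to the centred-comb dressing on the right. -/
theorem Khat_mul_PiHatC : Khat (d := d) n p * PiHatC (d := d) n p = Khat (d := d) n p :=
  (Khat_mul_PiHatC_and n p).1

/-- [folklore] **`Q̂′·Π̂′ = Q̂′`** — the (0.4)-symmetrised averaging is blind to the centred-comb dressing on the torus. -/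
theorem QhatSh_mul_PiHatC : QhatSh (d := d) n p * PiHatC (d := d) n p = QhatSh (d := d) n p :=
  (Khat_mul_PiHatC_and n p).2

/-- [folklore] **THE WARD LETTER (a0) ON THE TORUS AT CHART (III′): `K̂·Ŵ′₀ = 0`.** -/
theorem Khat_mul_What0C : Khat (d := d) n p * What0C (d := d) n p = 0 := by
  rw [What0C, ← Matrix.mul_assoc, Matrix.mul_sub, Matrix.mul_one, Khat_mul_PiHatC n p, sub_self, Matrix.zero_mul]

/-- [folklore] **THE KINEMATIC LETTER (b0) ON THE TORUS AT CHART (III′): `Q̂′·Ŵ′₀ = 0`.** -/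
theorem QhatSh_mul_What0C : QhatSh (d := d) n p * What0C (d := d) n p = 0 := by
  rw [What0C, ← Matrix.mul_assoc, Matrix.mul_sub, Matrix.mul_one, QhatSh_mul_PiHatC n p, sub_self, Matrix.zero_mul]

end Summit.QuantumFields.BalabanUV.Beta.D1BFx.TorusGaugeBasisC

end
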